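import Mathlib
import Literature.Analysis.FluidPDE.LoopCirculation
import Summits.NavierStokesRegularity.NavierStokesRegularity.Theorems.TautLoopKelvinTautLoopLawStepSchemeCircTools
import Summits.NavierStokesRegularity.NavierStokesRegularity.Theorems.TautLoopKelvinTautLoopLawStepWalkTailTools
import Summits.NavierStokesRegularity.NavierStokesRegularity.Theorems.TautLoopKelvinTautLoopLawStepImageLengthTools
import Summits.NavierStokesRegularity.NavierStokesRegularity.Theorems.TautLoopKelvinTautLoopLawLevelLeftContinuity
import Summits.NavierStokesRegularity.NavierStokesRegularity.Theorems.TautLoopKelvinTautLoopLawWalkSelectionAux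
import Summits.NavierStokesRegularity.NavierStokesRegularity.Theorems.TautLoopKelvinTautLoopLawWalkSelectionAux2
import HarnessLib

/-!
# Route `TautLoopKelvin`, crux `TautLoopLaw` (stmt-NavierStokesRegularity-15249), line
  `Sketch-ideas-r1k1` (Dini–Saks architecture) — tools stub `stub_tautLoopWalk6AAux4`

**The per-loop assembly of the random-walk Kelvin selection** (skeleton stub 6A
`stub_tautLoopWalkSelection`), stated abstractly for one time step `h = nτ`: given

* the backward flow maps `A_k` (`C¹`, `‖A_k y − y‖ ≤ Kτ`, `‖DA_k(y) − (1 − τ D_k(y))‖ ≤ Kτ²`,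
  slopes `‖D_k(y)‖ ≤ B₁`, `‖D_k(y) − Df₁(x)‖ ≤ B₂‖y − x‖ + Bt h`),
* the continuous scheme fields `θ_k` (`θ_0 = f₀`, six-point average of step `a` then exact
  transport by `A_k`) and a differentiable potential `Q` with `‖θ_n − f₁ − ∇Q‖ ≤ e_b`,
  `e_b L ≤ h^M/2`,
* the thresholds `hB₁ ≤ 1`, `Kh + 2λ ≤ 1`, the `o(h)` threshold and the two tail thresholds
  (`λ³ = h`, `a² = 6ν h/n`),

every closed `C¹` loop `γ` in the `R`-ball with `len γ ≤ L` and `∮_γ f₁ ≥ 0` has a partner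
`γ' = Ψ^{p} ∘ γ` (a recursively deformed loop along a bulk path `p`) which is a closed `C¹` loop
in the `(R+1)`-ball with `len γ' ≤ len γ · exp(h(κ + δ))` (`κ` the mean compression of `γ` in
`f₁`) and `∮_γ f₁ − h^M ≤ |∮_{γ'} f₀|`.

Mechanism: `∮_γ θ_n = 6⁻ⁿ Σ_p ∮_{L^p_0} f₀` (`stub_tautLoopStepSchemeCircTools`); gradients have
zero circulation, so `|∮_γ θ_n − ∮_γ f₁| ≤ e_b len γ ≤ h^M/2`; every `|∮_{L^p_0} f₀|` is at most
`B₀ e^{B₁+K} L`; the paths leaving the `λ`-ball are at most `12·6ⁿ e^{−1/(36νλ)}`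
(`stub_tautLoopStepWalkTailTools`); a mean is at most a max over the bulk; on the bulk the
composite differential is `1 − h Df₁ + o(h)` (`stub_tautLoopStepOpProductTools` via
`tautLoopWalk6A_composite`) and the first-order length bound
(`stub_tautLoopStepImageLengthTools`) gives the exponential length factor. Folklore
(Constantin–Iyer 2008, Prop. 2.10 in continuum form; Majda–Bertozzi 2002, §1.6).
-/

noncomputable section

open Set Function Filter Topology MeasureTheory intervalIntegral Literature.Analysis.FluidPDE
open scoped InnerProductSpace RealInnerProductSpace

namespace Summit.NavierStokesRegularity.NavierStokesRegularity.Theorems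

set_option linter.dupNamespace false

local notation3 "E3" => EuclideanSpace ℝ (Fin 3)

/-- Recursion for the literal partial sums of the translations of a path: `S_{k+1} = S_k + y(p k)`
for `k < n`. [folklore] -/
theorem tautLoopWalk6A_psum_succ {n : ℕ} (stp : Fin 6 → E3) (p : Fin n → Fin 6) (k : ℕ)
    (hk : k < n) :
    ∑ j ∈ Finset.univ.filter (fun j : Fin n => (j : ℕ) < k + 1), stp (p j) =
      ∑ j ∈ Finset.univ.filter (fun j : Fin n => (j : ℕ) < k), stp (p j) + stp (p ⟨k, hk⟩) := by
  rw [Finset.sum_filter, Finset.sum_filter]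
  have e : ∀ j : Fin n, (if (j : ℕ) < k + 1 then stp (p j) else 0) =
      (if (j : ℕ) < k then stp (p j) else 0) + (if j = ⟨k, hk⟩ then stp (p j) else 0) := by
    intro j
    by_cases h1 : (j : ℕ) < k
    · have h2 : (j : ℕ) < k + 1 := by omega
      have h3 : j ≠ ⟨k, hk⟩ := by
        intro h
        rw [h] at h1
        exact lt_irrefl _ h1
      simp [h1, h2, h3]
    · by_cases h2 : j = ⟨k, hk⟩
      · subst h2
        simp
      · have h3 : ¬ (j : ℕ) < k + 1 := by
          intro h
          apply h2
          ext
          simp only []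
          omega
        simp [h1, h2, h3]
  rw [Finset.sum_congr rfl fun j _ => e j, Finset.sum_add_distrib, Finset.sum_ite_eq']
  simp

/-- **Tools stub `stub_tautLoopWalk6AAux4`** (registered; the per-loop assembly for skeleton
stub 6A `stub_tautLoopWalkSelection`): random-walk Kelvin splitting on the loop side, crude
and bulk estimates for the deformed loops, tail count, and first-moment selection. [folklore] -/
theorem stub_tautLoopWalk6AAux4 : ∀ (ν : ℝ) (n M : ℕ) (τ h lam astep K B₀ B₁ B₂ Bt eb L R δ : ℝ) (f₀ f₁ : EuclideanSpace ℝ (Fin 3) → EuclideanSpace ℝ (Fin 3)) (A : ℕ → EuclideanSpace ℝ (Fin 3) → EuclideanSpace ℝ (Fin 3)) (Df : ℕ → EuclideanSpace ℝ (Fin 3) → (EuclideanSpace ℝ (Fin 3) →L[ℝ] EuclideanSpace ℝ (Fin 3))) (θ : ℕ → EuclideanSpace ℝ (Fin 3) → EuclideanSpace ℝ (Fin 3)) (Q : EuclideanSpace ℝ (Fin 3) → ℝ) (γ : ℝ → EuclideanSpace ℝ (Fin 3)), 0 < ν → 0 < n → 0 < τ → (n : ℝ) * τ = h → h ≤ 1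 → 0 < lam → lam ^ 3 = h → 0 < astep → astep ^ 2 = 6 * ν * (h / n) → 0 ≤ K → 0 ≤ B₀ → 0 ≤ B₁ → 0 ≤ B₂ → 0 ≤ Bt → Continuous f₀ → (∀ x, ‖f₀ x‖ ≤ B₀) → ContDiff ℝ 1 f₁ → (∀ x, ‖fderiv ℝ f₁ x‖ ≤ B₁) → (∀ k, k < n → ContDiff ℝ 1 (A k)) → (∀ k, k < n → ∀ y, ‖A k y - y‖ ≤ K * τ) → (∀ k, k < n → ∀ y, ‖fderiv ℝ (A k) y - (ContinuousLinearMap.id ℝ (EuclideanSpace ℝ (Fin 3)) - τ • Df k y)‖ ≤ K * τ ^ 2) → (∀ k, k < n → ∀ y, ‖Df k y‖ ≤ B₁) → (∀ k, k < n → ∀ x y, ‖Df k y - fderiv ℝ f₁ x‖ ≤ B₂ * ‖y - x‖ + Bt * h) → (∀ k, k ≤ n → Continuous (θ k)) → θ 0 = f₀ → (∀ k, k < n → ∀ x, θ (k + 1) x = ContinuousLinearMap.adjoint (fderiv ℝ (A k) x) ((1 / 6 : ℝ) • (∑ i : Fin 3, (θ k (A k x + astep • EuclideanSpace.single i (1:ℝ))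 + θ k (A k x - astep • EuclideanSpace.single i (1:ℝ)))))) → Differentiable ℝ Q → (∀ x, ‖θ n x - f₁ x - gradient Q x‖ ≤ eb) → eb * L ≤ h ^ M / 2 → h * B₁ ≤ 1 → K * h + 2 * lam ≤ 1 → (Real.exp (B₁ + K) * ((B₁ + K) ^ 2 + K) + B₂ * K + Bt + B₁ ^ 2) * h + 2 * B₂ * lam ≤ δ → 24 * (B₀ * Real.exp (B₁ + K) * L) * Real.exp (-(1 / (36 * ν * lam))) ≤ lam ^ (3 * M) → 13 * Real.exp (-(1 / (36 * ν * lam))) ≤ lam ^ 0 → Literature.Analysis.FluidPDE.IsC1Loop γ → (∀ σ, ‖γ σ‖ ≤ R) → (∫ σ in (0:ℝ)..1, ‖deriv γ σ‖) ≤ L → 0 ≤ Literature.Analysis.FluidPDE.circulation f₁ γ → ∃ γ' : ℝ → EuclideanSpace ℝ (Fin 3), Literature.Analysis.FluidPDE.IsC1Loop γ' ∧ (∀ σ, ‖γ' σ‖ ≤ R + 1) ∧ (∫ σ in (0:ℝ)..1, ‖deriv γ' σ‖) ≤ (∫ σ in (0:ℝ)..1, ‖deriv γ σ‖) * Real.exp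 (h * (((∫ σ in (0:ℝ)..1, -(inner ℝ (deriv γ σ) (fderiv ℝ f₁ (γ σ) (deriv γ σ))) / ‖deriv γ σ‖) / (∫ σ in (0:ℝ)..1, ‖deriv γ σ‖)) + δ)) ∧ Literature.Analysis.FluidPDE.circulation f₁ γ - h ^ M ≤ |Literature.Analysis.FluidPDE.circulation f₀ γ'| := by
  intro ν n M τ h lam astep K B₀ B₁ B₂ Bt eb L R δ f₀ f₁ A Df θ Q γ hν hn hτ hnτ hh1 hlam hlam3
    hastep hastep2 hK hB₀ hB₁ hB₂ hBt hf₀ hf₀B hf₁ hf₁B hA hAd hAT hDf hDfT hθc hθ0 hθrec hQ hrem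
    heb hhB₁ hρ heps hT1 hT2 hγ hγR hγL hΓ
  -- numerics
  have hn0 : (0 : ℝ) < n := Nat.cast_pos.2 hn
  have hh : 0 < h := by rw [← hnτ]; positivity
  have hτh : τ ≤ h := by
    have h1 : (1 : ℝ) ≤ n := Nat.one_le_cast.2 hn
    calc τ = 1 * τ := (one_mul τ).symm
      _ ≤ n * τ := mul_le_mul_of_nonneg_right h1 hτ.le
      _ = h := hnτ
  have hτ1 : τ ≤ 1 := hτh.trans hh1
  have hKτ0 : 0 ≤ K * τ := mul_nonneg hK hτ.le
  set ℓ := ∫ σ in (0:ℝ)..1, ‖deriv γ σ‖ with hℓ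
  have hℓ0 : 0 ≤ ℓ := intervalIntegral.integral_nonneg zero_le_one fun σ _ => norm_nonneg _
  have hL0 : 0 ≤ L := hℓ0.trans hγL
  have heb0 : 0 ≤ eb := (norm_nonneg _).trans (hrem 0)
  have hKu0 : 0 ≤ B₀ * Real.exp (B₁ + K) * L := by positivity
  have hexp1 : Real.exp (n * (τ * B₁ + K * τ ^ 2)) ≤ Real.exp (B₁ + K) := by
    refine Real.exp_le_exp.2 ?_
    have e1 : (n : ℝ) * (τ * B₁ + K * τ ^ 2) = h * B₁ + K * h * τ := by rw [← hnτ]; ring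
    rw [e1]
    refine add_le_add (mul_le_of_le_one_left hB₁ hh1) ?_
    calc K * h * τ ≤ K * 1 * 1 :=
          mul_le_mul (mul_le_mul_of_nonneg_left hh1 hK) hτ1 hτ.le (by rw [mul_one]; exact hK)
      _ = K := by ring
  have hρ' : (n : ℝ) * (K * τ) + 2 * lam ≤ 1 := by
    have e : (n : ℝ) * (K * τ) = K * h := by rw [← hnτ]; ring
    rw [e]
    exact hρ
  have hρ0 : 0 ≤ (n : ℝ) * (K * τ) + 2 * lam := by positivity
  have hε0 : 0 ≤ Real.exp (n * (τ * B₁ + K * τ ^ 2)) * ((n * (τ * B₁ + K * τ ^ 2)) ^ 2 +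
      n * (K * τ ^ 2)) + h * (B₂ * (n * (K * τ) + 2 * lam) + Bt * h) := by positivity
  have hR1 : R + ((n : ℝ) * (K * τ) + 2 * lam) ≤ R + 1 := add_le_add_right hρ' R
  have hkτ : ∀ k : ℕ, ((n : ℝ) - k) * (K * τ) ≤ n * (K * τ) := fun k =>
    mul_le_mul_of_nonneg_right (sub_le_self _ k.cast_nonneg) hKτ0
  -- the six steps, the translations of a path and their partial sums
  let stp : Fin 6 → E3 := fun c => (if ((c : Fin 6) : ℕ) % 2 = 0 then astep else -astep) •
    EuclideanSpace.single (⟨((c : Fin 6) : ℕ) / 2, by omega⟩ : Fin 3) (1:ℝ)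
  have hstp : ∀ c, ‖stp c‖ ≤ astep := by
    intro c
    have h1 : ‖(if ((c : Fin 6) : ℕ) % 2 = 0 then astep else -astep : ℝ)‖ = astep := by
      split_ifs <;> simp [abs_of_pos hastep]
    simp only [stp]
    rw [norm_smul, h1]
    simp
  let pe : (Fin n → Fin 6) → ℕ → Fin 6 := fun p k => if hk : k < n then p ⟨k, hk⟩ else 0
  have hpe : ∀ (p : Fin n → Fin 6) (k : ℕ) (hk : k < n), pe p k = p ⟨k, hk⟩ := fun p k hk =>
    dif_pos hk
  let yv : (Fin n → Fin 6) → ℕ → E3 := fun p k => stp (pe p k)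
  have hyv : ∀ (p : Fin n → Fin 6) (k : ℕ) (hk : k < n), yv p k = stp (p ⟨k, hk⟩) := by
    intro p k hk
    simp only [yv, hpe p k hk]
  have hyvn : ∀ (p : Fin n → Fin 6) (k : ℕ), k < n → ‖yv p k‖ ≤ astep := fun p k _ => hstp _
  let S : (Fin n → Fin 6) → ℕ → E3 := fun p k =>
    ∑ j ∈ Finset.univ.filter (fun j : Fin n => (j : ℕ) < k), stp (p j)
  have hS0 : ∀ p, S p 0 = 0 := by
    intro p
    simp [S]
  have hSrec : ∀ (p : Fin n → Fin 6) (k : ℕ), k < n → S p (k + 1) = S p k + yv p k := by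
    intro p k hk
    rw [hyv p k hk]
    exact tautLoopWalk6A_psum_succ stp p k hk
  -- the composite maps `Ψ^p_k = Φ_k ∘ ⋯ ∘ Φ_{n-1}`, `Φ_k = A_k + y(p k)`, and the loops
  let Ψ : (Fin n → Fin 6) → ℕ → E3 → E3 := fun p k =>
    @Nat.rec (fun _ => E3 → E3) id
      (fun m Ψm => fun x => A (n - (m + 1)) (Ψm x) + yv p (n - (m + 1))) (n - k)
  have hΨn : ∀ p x, Ψ p n x = x := by
    intro p x
    simp only [Ψ, Nat.sub_self]
    rfl
  have hΨrec : ∀ (p : Fin n → Fin 6) (k : ℕ), k < n → ∀ x,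
      Ψ p k x = A k (Ψ p (k + 1) x) + yv p k := by
    intro p k hk x
    have e : n - k = (n - (k + 1)) + 1 := by omega
    have e2 : n - (n - (k + 1) + 1) = k := by omega
    show @Nat.rec (fun _ => E3 → E3) id
      (fun m Ψm => fun x => A (n - (m + 1)) (Ψm x) + yv p (n - (m + 1))) (n - k) x = _
    rw [e]
    show A (n - (n - (k + 1) + 1)) _ + yv p (n - (n - (k + 1) + 1)) = _
    rw [e2]
  let Lp : (Fin n → Fin 6) → ℕ → ℝ → E3 := fun p k σ => Ψ p k (γ σ)
  -- the loop side of the scheme: `∮_γ θ_n = 6⁻ⁿ Σ_p ∮_{L^p_0} θ_0`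
  obtain ⟨hLpC1, hcirc⟩ := stub_tautLoopStepSchemeCircTools n astep A θ γ Lp hA hθc hγ hθrec
    (fun p => funext fun σ => hΨn p (γ σ)) (fun p k hk σ => by
      show Ψ p k (γ σ) = A k (Ψ p (k + 1) (γ σ)) + _
      rw [hΨrec p k hk, hyv p k hk])
  -- the field side: `|∮_γ θ_n − ∮_γ f₁| ≤ e_b len γ`
  have hD : |circulation (θ n) γ - circulation f₁ γ| ≤ eb * ℓ :=
    tautLoopWalk6A_circulation_sub_le (θ n) f₁ Q γ eb (hθc n le_rfl) hf₁.continuous hQ hγ hrem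
  -- crude bounds for every path
  have hcomp := fun p : Fin n → Fin 6 => tautLoopWalk6A_composite n τ K B₁ astep A (Ψ p) Df
    (yv p) hτ.le hK hB₁ hastep.le hA hAd hAT hDf (hyvn p) (hΨn p) (hΨrec p)
  have hF : ∀ p, |circulation f₀ (Lp p 0)| ≤ B₀ * Real.exp (B₁ + K) * L := by
    intro p
    have hlen : (∫ σ in (0:ℝ)..1, ‖deriv (Lp p 0) σ‖) ≤ Real.exp (B₁ + K) * ℓ :=
      tautLoopWalk6A_len_comp_le (Ψ p 0) γ (Real.exp (B₁ + K)) ((hcomp p).1 0 (Nat.zero_le _))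
        hγ (fun x => ((hcomp p).2.1 x).trans hexp1)
    calc |circulation f₀ (Lp p 0)| ≤ B₀ * ∫ σ in (0:ℝ)..1, ‖deriv (Lp p 0) σ‖ :=
          tautLoopLlc_abs_circulation_le hf₀ (hLpC1 p 0 (Nat.zero_le _)) fun σ => hf₀B _
      _ ≤ B₀ * (Real.exp (B₁ + K) * ℓ) := by gcongr
      _ ≤ B₀ * (Real.exp (B₁ + K) * L) := by gcongr
      _ = B₀ * Real.exp (B₁ + K) * L := by ring
  -- the bad paths and the tail count
  set Bad := Finset.univ.filter (fun p : Fin n → Fin 6 => ∃ k : ℕ, k ≤ n ∧ lam <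
    ‖∑ j ∈ Finset.univ.filter (fun j : Fin n => (j : ℕ) < k),
      (if (p j : ℕ) % 2 = 0 then astep else -astep) •
        EuclideanSpace.single (⟨(p j : ℕ) / 2, by omega⟩ : Fin 3) (1:ℝ)‖) with hBad
  have hcnt : (Bad.card : ℝ) ≤ 12 * (6 : ℝ) ^ n * Real.exp (-(lam ^ 2) / (6 * n * astep ^ 2)) :=
    stub_tautLoopStepWalkTailTools n astep lam hastep hlam hn
  obtain ⟨htail, hlt⟩ := tautLoopWalk6A_tail_arith ν h lam astep (B₀ * Real.exp (B₁ + K) * L)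
    Bad.card n M hν hn hlam hlam3 hastep2 hKu0 hcnt hT1 hT2
  -- first-moment selection
  have hN : (Fintype.card (Fin n → Fin 6) : ℝ) = (6 : ℝ) ^ n := by
    rw [Fintype.card_fun, Fintype.card_fin, Fintype.card_fin]
    push_cast
    ring
  have havg : |((6 : ℝ) ^ n)⁻¹ * (∑ p, circulation f₀ (Lp p 0)) - circulation f₁ γ| ≤
      h ^ M / 2 := by
    have e1 : ((6 : ℝ) ^ n)⁻¹ * (∑ p, circulation f₀ (Lp p 0)) = circulation (θ n) γ := by
      rw [hcirc, hθ0, one_div, inv_pow]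
    rw [e1]
    exact hD.trans ((mul_le_mul_of_nonneg_left hγL heb0).trans heb)
  obtain ⟨p, hpBad, hsel⟩ := tautLoopWalk6A_select Bad (fun p => circulation f₀ (Lp p 0))
    (circulation f₁ γ) (B₀ * Real.exp (B₁ + K) * L) (h ^ M) ((6 : ℝ) ^ n) hN (by positivity)
    havg hF htail hlt
  -- the selected path stays in the `λ`-ball
  have hgood : ∀ k, k ≤ n → ‖S p k‖ ≤ lam := by
    intro k hk
    by_contra hcon
    exact hpBad (Finset.mem_filter.2 ⟨Finset.mem_univ _, k, hk, lt_of_not_ge hcon⟩)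
  -- bulk estimates along the selected path
  have hdisp : ∀ x, ∀ k, k ≤ n → ‖Ψ p k x - x‖ ≤ n * (K * τ) + 2 * lam := by
    intro x k hk
    have h1 := tautLoopWalk6A_disp_partial n A (Ψ p) (yv p) (S p) (K * τ) x hAd (hS0 p)
      (fun k hk => hSrec p k hk) (hΨn p x) (fun k hk => hΨrec p k hk x) k hk
    calc ‖Ψ p k x - x‖ = ‖(Ψ p k x - x - (S p n - S p k)) + (S p n - S p k)‖ := by
          rw [sub_add_cancel]
      _ ≤ (n - k) * (K * τ) + (‖S p n‖ + ‖S p k‖) := norm_add_le_of_le h1 (norm_sub_le _ _)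
      _ ≤ n * (K * τ) + (lam + lam) :=
        add_le_add (hkτ k) (add_le_add (hgood n le_rfl) (hgood k hk))
      _ = n * (K * τ) + 2 * lam := by ring
  have hslope : ∀ x, ∀ k, k < n →
      ‖Df k (Ψ p (k + 1) x) - fderiv ℝ f₁ x‖ ≤ B₂ * (n * (K * τ) + 2 * lam) + Bt * h :=
    fun x k hk => (hDfT k hk x _).trans
      (add_le_add_left (mul_le_mul_of_nonneg_left (hdisp x (k + 1) hk) hB₂) _)
  have hDΨ : ∀ σ, ‖fderiv ℝ (Ψ p 0) (γ σ) - (ContinuousLinearMap.id ℝ E3 +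
      h • (fun x => -fderiv ℝ f₁ x) (γ σ))‖ ≤
      Real.exp (n * (τ * B₁ + K * τ ^ 2)) * ((n * (τ * B₁ + K * τ ^ 2)) ^ 2 +
        n * (K * τ ^ 2)) + h * (B₂ * (n * (K * τ) + 2 * lam) + Bt * h) := by
    intro σ
    have h1 := (hcomp p).2.2 (fderiv ℝ f₁ (γ σ)) _ (γ σ) (hslope (γ σ))
    rwa [hnτ] at h1
  -- the first-order length bound on the bulk
  have hIL := stub_tautLoopStepImageLengthTools (Ψ p 0) (fun x => -fderiv ℝ f₁ x) γ h _ B₁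
    hh.le hε0 hB₁ hhB₁ ((hcomp p).1 0 (Nat.zero_le _)) (hf₁.continuous_fderiv one_ne_zero).neg
    hγ hDΨ (fun σ => by rw [norm_neg]; exact hf₁B _)
  have hNabs : |∫ σ in (0:ℝ)..1, (inner ℝ (deriv γ σ) ((fun x => -fderiv ℝ f₁ x) (γ σ)
      (deriv γ σ))) / ‖deriv γ σ‖| ≤ B₁ * ℓ := by
    rw [← Real.norm_eq_abs, hℓ, ← intervalIntegral.integral_const_mul]
    exact intervalIntegral.norm_integral_le_of_norm_le zero_le_one
      (Filter.Eventually.of_forall fun σ _ => tautLoopImgLen_norm_quot_le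
        (B := fun x => -fderiv ℝ f₁ x) (γ := γ) (fun σ => by rw [norm_neg]; exact hf₁B _) σ)
      ((continuous_const.mul hγ.continuous_deriv.norm).intervalIntegrable 0 1)
  have hNeq : (∫ σ in (0:ℝ)..1, (inner ℝ (deriv γ σ) ((fun x => -fderiv ℝ f₁ x) (γ σ)
      (deriv γ σ))) / ‖deriv γ σ‖) =
      ∫ σ in (0:ℝ)..1, -(inner ℝ (deriv γ σ) (fderiv ℝ f₁ (γ σ) (deriv γ σ))) / ‖deriv γ σ‖ := by
    refine intervalIntegral.integral_congr fun σ _ => ?_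
    simp only [neg_apply, inner_neg_right]
  rw [hNeq] at hIL hNabs
  have hsmall := tautLoopWalk6A_eps_arith n τ h K B₁ B₂ Bt lam δ hnτ hh.le hh1 hτ.le hτh hK hB₁
    heps
  rw [hnτ] at hsmall
  have hlen' := tautLoopWalk6A_len_algebra ℓ (∫ σ in (0:ℝ)..1, ‖deriv (Ψ p 0 ∘ γ) σ‖) _ h _ B₁ δ
    hℓ0 hNabs hIL hsmall
  -- the partner loop
  refine ⟨Lp p 0, hLpC1 p 0 (Nat.zero_le _), fun σ => ?_, hlen', ?_⟩
  · calc ‖Lp p 0 σ‖ = ‖γ σ + (Ψ p 0 (γ σ) - γ σ)‖ := by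
          show ‖Ψ p 0 (γ σ)‖ = _
          rw [add_sub_cancel]
      _ ≤ R + (n * (K * τ) + 2 * lam) := norm_add_le_of_le (hγR σ) (hdisp (γ σ) 0 (Nat.zero_le _))
      _ ≤ R + 1 := hR1
  · exact hsel

end Summit.NavierStokesRegularity.NavierStokesRegularity.Theorems

end
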